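/-
Copyright (c) 2026 the pub-hodgecm-mathlib formalisation cell (harness21).  Prover seat hodgecm-mathlib-F0P2-p10 (g0) (strike line L1, LEAD F0P6-plan (g14)),
Track B «K2-LIT», #184♮ = hLiu418 = `stmt-HodgeConjecture-24832`; Road I v3, S5-F3 lineage ∕ I4-conv (F′-fact): THE GLUE of the `hlaw` chain and the per-place head.
-/
import Summits.HodgeConjecture.HodgeConjecture.Theorems.K2LiuKlingenInnerSectionLocalLaw          -- ★ F0P2-p09: `innerSectionLoc_upper_mul` (the `hlaw` payer, hypothesis-first)
import Summits.HodgeConjecture.HodgeConjecture.Theorems.K2LiuKlingenInnerSectionLocalCharacter    -- ★ (D1)+(D3): `lambdaLoc_psiv_levi_mul`, `lambdaLoc_psiv_uPlus_mul`, `siegelCharLoc_psiv_…`, `hlaw_of_upper_mul`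
import Summits.HodgeConjecture.HodgeConjecture.Theorems.K2LiuLocalRingHaarModulus                 -- ★ (D2): `addHaar_map_mul_right_family`, `toReal_prod_nnnorm_inv_family`
import Summits.HodgeConjecture.HodgeConjecture.Theorems.K2LiuKlingenInnerSectionSpherical         -- ★ C: `apply_eq_apply_one_mul_lambdaLoc_apply`
import Summits.HodgeConjecture.HodgeConjecture.Theorems.K2LiuKlingenInnerSectionLocalInvariance   -- ★ `hK` payer (K2Liu-p14): `innerSectionLoc_lambdaLoc_mul_localInt`
import HarnessLib

/-!
# Crux `HLiu418`, I4-conv (F′-fact) — `K2LiuKlingenInnerSectionLocalLawAssembly`: THE `hlaw` CHAIN CLOSED BY NAME, AND THE PER-PLACE HEAD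
# `J_v(b g) = ∏_w χ_w(u_w) · (∏_w ‖u_w‖_w)^{(s−½)+½} · J_v(g)` and `J_v(x) = J_v(1) · Λ^{line}_{s−½,v}(κ x)` for `J_v := innerSectionLoc v ν_Y ν_T Ψ_v Λ_{s,v} x_v`

Cell `hodgecm-mathlib`, crux item hLiu418 = `stmt-HodgeConjecture-24832`; squad K2 ∕ K2Liu; LEAD F0P6-plan (g14); organ U1 (I4-conv, desk K2Liu-p14 (g3)).  THEOREMS ONLY (no `def`,
no instance, no notation, no named-fact hypothesis, no `sorry`); lane `--supports stmt-HodgeConjecture-24832 --as helper` (count-neutral).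
THE POINT.  The local inner functional of the Klingen fibre, `J_v := innerSectionLoc L v νY νT Ψv (LambdaLoc … v χ s) xv` (★ B), for ANY additive Haar measure `νT` on
`L_v = Π_{w∣v} L_w` (any Borel structure) and any left-invariant s-finite `νY` on the skew part:
* §1 **`innerSectionLoc_lambdaLoc_upper_mul`** — ITS LOCAL BOREL LAW IN ENTRIES = VERBATIM the binder `hlaw` of ★ C `K2LiuKlingenInnerSectionSpherical` §4 at `σ := s − ½`:
  ★ F0P2-p09 `innerSectionLoc_upper_mul` (hypothesis-first: `hνT`, `hfP`, `hfU`, `cΔ`, `mT` by value) with EVERY letter paid by name — `hνT` ∕ `hmT` ← ★ (D2)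
  `addHaar_map_mul_right_family` ∕ `toReal_prod_nnnorm_inv_family` (`mT u = ∏_w ‖u_w⁻¹‖_w`, Mathlib `MulEquiv.piUnits` between the two index conventions), `hfP` ∕ `hfU` ∕ the
  VALUE of `cΔ` ← ★ (D1)+(D3) `lambdaLoc_psiv_levi_mul` ∕ `lambdaLoc_psiv_uPlus_mul` ∕ `siegelCharLoc_psiv_weylXi_conj_klingenLevi`, assembled by ★ `hlaw_of_upper_mul`;
* §2 **`innerSectionLoc_lambdaLoc_eq_apply_one_mul_lambdaLoc`** — THE PER-PLACE HEAD `J_v(x) = J_v(1) · Λ^{line}_{s−½,v}(κ x)` for every local line bridge `κ` of record shape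
  (`hκ`), at a good place (`|2|_w = 1`, `χ` unramified above `v`, `Ψ_v(K) ⊆ K`, `x_v ∈ K`): ★ C `apply_eq_apply_one_mul_lambdaLoc_apply` fed by §1 (`hlaw`) and by K2Liu-p14's ★
  `innerSectionLoc_lambdaLoc_mul_localInt` (`hK`) — the per-place discharge, BY NAME, of the binder `hJ` of ★ E-2 `K2LiuKlingenInnerSectionFactorizable` (`c_v := J_v(1)`,
  `σ := s − ½`), up to E's choice of the bridge `κ_v`.
* §3 **`innerSectionLoc_lambdaLoc_eq_apply_one_mul_lambdaLoc_localCongr`** — §2 at the bridge of record `κ := ★ UnitaryGroup.localCongr … S … hc v` (★ C §5 shape,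
  `hκ := ★ localCongr_apply_eq_conj`).
The Siegel embedding `Ψ_v` is pinned BY VALUE exactly as in ★ (D1)+(D3) (`SAw`, `Xw`, `Yw`, `aw`, `haw`, `hSAw`, `hSAwi`, `hΨv`: `Ψ_v(z)_w = S_{A,w} z_w S_{A,w}⁻¹` with the
doubled-basis frame).  [MoeglinWaldspurger1995, II.1.7], [Casselman1980, §3], [Tan1999, §1–§2], [HarrisKudlaSweet1996, §1 (1.15)], [WeilBNT1967, Ch. IV §3].
HONEST LABEL.  Count-neutral helper: `HC_CM` is proved only modulo the 7 printed citations (2 remaining named inputs: hLiu418 = `stmt-HodgeConjecture-24832`,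
h413 = `stmt-HodgeConjecture-24833`) until rung 0 closes; this file closes no socket by itself.

## Mathlib ∕ tree search
Tree ★: `K2LiuKlingenInnerSectionLocalLaw.innerSectionLoc_upper_mul` (F0P2-p09), `K2LiuKlingenInnerSectionLocalCharacter.{lambdaLoc_psiv_levi_mul, lambdaLoc_psiv_uPlus_mul,
siegelCharLoc_psiv_weylXi_conj_klingenLevi, hlaw_of_upper_mul}`, `K2LiuLocalRingHaarModulus.{addHaar_map_mul_right_family, toReal_prod_nnnorm_inv_family}`,
`K2LiuKlingenInnerSectionSpherical.apply_eq_apply_one_mul_lambdaLoc_apply`, `K2LiuKlingenInnerSectionLocalInvariance.innerSectionLoc_lambdaLoc_mul_localInt` (K2Liu-p14).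
Mathlib: `MulEquiv.piUnits`.  Dedup: `rg "innerSectionLoc_lambdaLoc_upper|LocalLawAssembly" Summits/` — none.
-/

set_option autoImplicit false
set_option linter.dupNamespace false -- the mandated namespace repeats `HodgeConjecture.HodgeConjecture`

noncomputable section

open scoped Matrix NNReal ENNReal
open NumberField IsDedekindDomain MeasureTheory
open Literature.NumberTheory.Automorphic Literature.NumberTheory.Automorphic.UnitaryGroup
open Literature.NumberTheory.GaloisRepresentations
open Literature.NumberTheory.GelbartRogawski1991 Literature.NumberTheory.GelbartRogawski1991.GRConstruction
open Literature.NumberTheory.GelbartRogawski1991.UnitaryDualPair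
open Literature.NumberTheory.K2Lit.SiegelDoubled Literature.NumberTheory.K2Lit.LocalSiegelDoubled
open Summit.HodgeConjecture.HodgeConjecture.Cruxes.HLiu418.K2LiuKlingenParabolicDefs
open Summit.HodgeConjecture.HodgeConjecture.Cruxes.HLiu418.K2LiuDoubledUTwoTwoBorelFrame
open Summit.HodgeConjecture.HodgeConjecture.Cruxes.HLiu418.K2LiuKlingenInnerSectionLocalDefs
open Summit.HodgeConjecture.HodgeConjecture.Cruxes.HLiu418.K2LiuKlingenInnerSectionLocalLaw (innerSectionLoc_upper_mul)
open Summit.HodgeConjecture.HodgeConjecture.Cruxes.HLiu418.K2LiuKlingenInnerSectionLocalCharacter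
open Summit.HodgeConjecture.HodgeConjecture.Cruxes.HLiu418.K2LiuLocalRingHaarModulus (addHaar_map_mul_right_family toReal_prod_nnnorm_inv_family)
open Summit.HodgeConjecture.HodgeConjecture.Cruxes.HLiu418.K2LiuKlingenInnerSectionSpherical (apply_eq_apply_one_mul_lambdaLoc_apply)
open Summit.HodgeConjecture.HodgeConjecture.Cruxes.HLiu418.K2LiuLineBridgeLocalDictionary (localCongr_apply_eq_conj)
open Summit.HodgeConjecture.HodgeConjecture.Cruxes.HLiu418.K2LiuKlingenInnerSectionLocalInvariance (innerSectionLoc_lambdaLoc_mul_localInt)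

namespace Summit.HodgeConjecture.HodgeConjecture.Cruxes.HLiu418.K2LiuKlingenInnerSectionLocalLawAssembly

variable (L : Type) [Field L] [NumberField L] [IsCMField L]
variable {N M : ℕ} (e : Fin N × Fin M ≃ Fin 2)
  (dV : Fin N → L) (hdV : ∀ i, IsCMField.complexConj L (dV i) = dV i)
  (dW : Fin M → L) (hdW : ∀ i, IsCMField.complexConj L (dW i) = dW i)
  (v : HeightOneSpectrum (𝓞 (Fp L)))
  (Ψv : UnitaryGroup.localPi L (IsCMField.complexConj L) 4 ((StdForm.antidiagonal 4).over L) v →*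
    UnitaryGroup.localPi L (IsCMField.complexConj L) (2 + 2) (hermD L e dV hdV dW hdW) v)
  (SAw : ∀ w : UnitaryGroup.PlacesOver L v, GL (Fin 4) (w.1.adicCompletion L))
  (Xw Yw : ∀ w : UnitaryGroup.PlacesOver L v, Matrix (Fin 2) (Fin 2) (w.1.adicCompletion L))
  (aw : ∀ w : UnitaryGroup.PlacesOver L v, w.1.adicCompletion L)
  (haw : ∀ w, aw w + aw w = 1)
  (hSAw : ∀ w, Matrix.reindex (e₂ (n := 2)).symm (e₂ (n := 2)).symm ((SAw w : GL (Fin 4) (w.1.adicCompletion L)) : Matrix (Fin 4) (Fin 4) (w.1.adicCompletion L)) =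
    Matrix.fromBlocks 1 (Xw w) 1 (-(Xw w)))
  (hSAwi : ∀ w, Matrix.reindex (e₂ (n := 2)).symm (e₂ (n := 2)).symm (((SAw w)⁻¹ : GL (Fin 4) (w.1.adicCompletion L)) : Matrix (Fin 4) (Fin 4) (w.1.adicCompletion L)) =
    Matrix.fromBlocks (aw w • (1 : Matrix (Fin 2) (Fin 2) (w.1.adicCompletion L))) (aw w • 1) (Yw w) (-(Yw w)))
  (hΨv : ∀ (z : UnitaryGroup.localPi L (IsCMField.complexConj L) 4 ((StdForm.antidiagonal 4).over L) v) (w : UnitaryGroup.PlacesOver L v),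
    (((Ψv z : UnitaryGroup.localPi L (IsCMField.complexConj L) (2 + 2) (hermD L e dV hdV dW hdW) v) : UnitaryGroup.LocalGLPi L (2 + 2) v) w :
        Matrix (Fin (2 + 2)) (Fin (2 + 2)) (w.1.adicCompletion L)) =
      ((SAw w : GL (Fin 4) (w.1.adicCompletion L)) : Matrix (Fin 4) (Fin 4) (w.1.adicCompletion L)) *
        (((z : UnitaryGroup.LocalGLPi L 4 v) w : GL (Fin 4) (w.1.adicCompletion L)) : Matrix (Fin 4) (Fin 4) (w.1.adicCompletion L)) *
        (((SAw w)⁻¹ : GL (Fin 4) (w.1.adicCompletion L)) : Matrix (Fin 4) (Fin 4) (w.1.adicCompletion L)))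

/-! ## §1 The local Borel law of `J_v = innerSectionLoc v ν_Y ν_T Ψ_v Λ_{s,v} x_v` — ★ C's binder `hlaw` at `σ = s − ½`, every letter paid by name -/

include haw hSAw hSAwi hΨv in
/-- **THE LOCAL BOREL LAW OF THE INNER FUNCTIONAL, CLOSED BY NAME.**  For ANY additive Haar measure `ν_T` on `L_v` (any Borel structure), any s-finite left-invariant
`ν_Y` on the skew part, `χ` unramified above `v`, and upper-triangular `b ∈ U(J₂)(L⁺_v)` with corner units `u_w = (b_w)₀₀`:
`J_v(b g) = ∏_w χ_w(u_w) · (∏_w ‖u_w‖_w)^{(s − ½) + ½} · J_v(g)` — VERBATIM the binder `hlaw` of ★ C `K2LiuKlingenInnerSectionSpherical` §4 at `σ := s − ½`, for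
`Jv := innerSectionLoc L v νY νT Ψv (LambdaLoc … v χ s) xv`.  Proof: ★ `hlaw_of_upper_mul` ∘ (★ F0P2-p09 `innerSectionLoc_upper_mul` with `hνT` ← ★ (D2), `hfP`∕`hfU` ← ★ (D3))
with `hcΔ` ← ★ (D1) and `hmT` ← ★ (D2). [cite: MoeglinWaldspurger1995, II.1.7] [cite: Casselman1980, §3] [cite: HarrisKudlaSweet1996, §1 (1.15)] [cite: WeilBNT1967, Ch. IV §3] -/
theorem innerSectionLoc_lambdaLoc_upper_mul
    [MeasurableSpace ↥(skewLoc L v)] [BorelSpace ↥(skewLoc L v)] [MeasurableSpace (UnitaryGroup.LocalRing L v)] [BorelSpace (UnitaryGroup.LocalRing L v)]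
    (νY : Measure ↥(skewLoc L v)) (νT : Measure (UnitaryGroup.LocalRing L v)) [SFinite νY] [SFinite νT] [νY.IsAddLeftInvariant] [νT.IsAddHaarMeasure]
    (χ : HeckeCharacter L) (s : ℂ) (hχ : ∀ w : UnitaryGroup.PlacesOver L v, χ.IsUnramifiedAt w.1)
    (xv : UnitaryGroup.localPi L (IsCMField.complexConj L) (2 + 2) (hermD L e dV hdV dW hdW) v)
    (b g : UnitaryGroup.localPi L (IsCMField.complexConj L) 2 ((StdForm.antidiagonal 2).over L) v)
    (u : ∀ w : UnitaryGroup.PlacesOver L v, (w.1.adicCompletion L)ˣ)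
    (hb : ∀ w : UnitaryGroup.PlacesOver L v,
      (((b : UnitaryGroup.LocalGLPi L 2 v) w : GL (Fin 2) (w.1.adicCompletion L)) : Matrix (Fin 2) (Fin 2) (w.1.adicCompletion L)) 1 0 = 0)
    (hu : ∀ w : UnitaryGroup.PlacesOver L v, (u w : w.1.adicCompletion L) =
      (((b : UnitaryGroup.LocalGLPi L 2 v) w : GL (Fin 2) (w.1.adicCompletion L)) : Matrix (Fin 2) (Fin 2) (w.1.adicCompletion L)) 0 0) :
    innerSectionLoc L v νY νT Ψv (LambdaLoc L e dV hdV dW hdW v χ s) xv (b * g) =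
      (∏ w : UnitaryGroup.PlacesOver L v, ((χ.localComponent w.1 (u w) : ℂˣ) : ℂ)) *
        (((∏ w : UnitaryGroup.PlacesOver L v, ‖(u w : w.1.adicCompletion L)‖ : ℝ) : ℂ) ^ (s - 1 / 2 + 1 / 2)) *
        innerSectionLoc L v νY νT Ψv (LambdaLoc L e dV hdV dW hdW v χ s) xv g :=
  hlaw_of_upper_mul L v χ s (Jv := innerSectionLoc L v νY νT Ψv (LambdaLoc L e dV hdV dW hdW v χ s) xv)
    (mT := fun U : (UnitaryGroup.LocalRing L v)ˣ => ((∏ w : UnitaryGroup.PlacesOver L v,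
      ‖(((MulEquiv.piUnits U w)⁻¹ : (w.1.adicCompletion L)ˣ) : w.1.adicCompletion L)‖₊ : ℝ≥0) : ℝ≥0∞))
    (fun b g U hb hU => innerSectionLoc_upper_mul L v νY νT
      (fun u : ∀ w : UnitaryGroup.PlacesOver L v, (w.1.adicCompletion L)ˣ =>
        ((∏ w : UnitaryGroup.PlacesOver L v, ‖(((u w)⁻¹ : (w.1.adicCompletion L)ˣ) : w.1.adicCompletion L)‖₊ : ℝ≥0) : ℝ≥0∞))
      (addHaar_map_mul_right_family (Fp L) L v νT) Ψv (LambdaLoc L e dV hdV dW hdW v χ s) xv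
      (fun b => siegelCharLoc L e dV hdV dW hdW v χ s
        (Ψv (jLoc L 4 v (weylXi (UnitaryGroup.LocalRing L v) (conjLocal L (IsCMField.complexConj L) v) *
          klingenLevi (UnitaryGroup.LocalRing L v) (conjLocal L (IsCMField.complexConj L) v) (conjLocal_conjLocal_cm L v) 1 ((jLoc L 2 v).symm b) *
          (weylXi (UnitaryGroup.LocalRing L v) (conjLocal L (IsCMField.complexConj L) v))⁻¹))))
      (lambdaLoc_psiv_levi_mul L e dV hdV dW hdW v Ψv SAw Xw Yw aw haw hSAw hSAwi hΨv χ s hχ)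
      (lambdaLoc_psiv_uPlus_mul L e dV hdV dW hdW v Ψv SAw Xw Yw aw haw hSAw hSAwi hΨv χ s hχ)
      b g hb (MulEquiv.piUnits U) hU)
    (fun b u hb hu => siegelCharLoc_psiv_weylXi_conj_klingenLevi L e dV hdV dW hdW v Ψv SAw Xw Yw aw haw hSAw hSAwi hΨv χ s b u hb hu)
    (fun U => toReal_prod_nnnorm_inv_family (Fp L) L v (MulEquiv.piUnits U))
    b g u hb hu

/-! ## §2 The per-place head: `J_v(x) = J_v(1) · Λ^{line}_{s−½,v}(κ x)` -/

include haw hSAw hSAwi hΨv in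
/-- **THE PER-PLACE HEAD OF THE KLINGEN-FIBRE INNER FUNCTIONAL.**  At a good place `v` (`|2|_w = 1` for `w ∣ v`, `χ` unramified above `v`), for ANY additive Haar `ν_T`
and s-finite left-invariant `ν_Y`, a Siegel embedding `Ψ_v` of the doubled frame preserving integral points (`hΨK`) and an integral base point `x_v` (`hxv`), and ANY local
line bridge `κ : U(J₂)(L⁺_v) ≃ U(H₁)(L⁺_v)` of record shape (`hκ`, matrix `S` with `hS`, `hS'`):
`J_v(x) = J_v(1) · Λ^{line}_{s − ½, v}(κ x)` for `J_v := innerSectionLoc L v νY νT Ψv (LambdaLoc … v χ s) xv` — ★ C `apply_eq_apply_one_mul_lambdaLoc_apply` with `hlaw` ← §1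
and `hK` ← K2Liu-p14's ★ `innerSectionLoc_lambdaLoc_mul_localInt`; the per-place form of the binder `hJ` of ★ E-2 (`c_v := J_v(1)`, `σ := s − ½`).
[cite: Casselman1980, §3] [cite: Tan1999, §1] [cite: MoeglinWaldspurger1995, II.1.7] -/
theorem innerSectionLoc_lambdaLoc_eq_apply_one_mul_lambdaLoc
    [MeasurableSpace ↥(skewLoc L v)] [BorelSpace ↥(skewLoc L v)] [MeasurableSpace (UnitaryGroup.LocalRing L v)] [BorelSpace (UnitaryGroup.LocalRing L v)]
    (νY : Measure ↥(skewLoc L v)) (νT : Measure (UnitaryGroup.LocalRing L v)) [SFinite νY] [SFinite νT] [νY.IsAddLeftInvariant] [νT.IsAddHaarMeasure]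
    (S : GL (Fin 2) L) (hS : (S : Matrix (Fin 2) (Fin 2) L) = !![1, 2⁻¹; 1, -2⁻¹])
    (hS' : ((S⁻¹ : GL (Fin 2) L) : Matrix (Fin 2) (Fin 2) L) = !![2⁻¹, 2⁻¹; 1, -1])
    (κ : UnitaryGroup.localPi L (IsCMField.complexConj L) 2 ((StdForm.antidiagonal 2).over L) v ≃ₜ*
      UnitaryGroup.localPi L (IsCMField.complexConj L) (1 + 1)
        (hermD L (Equiv.prodUnique (Fin 1) (Fin 1)) (fun _ => (1 : L)) (fun _ => map_one _) (fun _ => (1 : L)) (fun _ => map_one _)) v)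
    (hκ : ∀ (x : UnitaryGroup.localPi L (IsCMField.complexConj L) 2 ((StdForm.antidiagonal 2).over L) v) (w : UnitaryGroup.PlacesOver L v),
      (κ x : UnitaryGroup.LocalGLPi L (1 + 1) v) w =
        Matrix.GeneralLinearGroup.map (algebraMap L (w.1.adicCompletion L)) S * (x : UnitaryGroup.LocalGLPi L 2 v) w *
          (Matrix.GeneralLinearGroup.map (algebraMap L (w.1.adicCompletion L)) S)⁻¹)
    (χ : HeckeCharacter L) (s : ℂ) (hχ : ∀ w : UnitaryGroup.PlacesOver L v, χ.IsUnramifiedAt w.1)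
    (h2 : ∀ w : UnitaryGroup.PlacesOver L v, ValuativeRel.valuation (w.1.adicCompletion L) (2 : w.1.adicCompletion L) = 1)
    (hΨK : ∀ k ∈ UnitaryGroup.localInt L (IsCMField.complexConj L) 4 ((StdForm.antidiagonal 4).over L) v,
      Ψv k ∈ UnitaryGroup.localInt L (IsCMField.complexConj L) (2 + 2) (hermD L e dV hdV dW hdW) v)
    {xv : UnitaryGroup.localPi L (IsCMField.complexConj L) (2 + 2) (hermD L e dV hdV dW hdW) v}
    (hxv : xv ∈ UnitaryGroup.localInt L (IsCMField.complexConj L) (2 + 2) (hermD L e dV hdV dW hdW) v)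
    (x : UnitaryGroup.localPi L (IsCMField.complexConj L) 2 ((StdForm.antidiagonal 2).over L) v) :
    innerSectionLoc L v νY νT Ψv (LambdaLoc L e dV hdV dW hdW v χ s) xv x =
      innerSectionLoc L v νY νT Ψv (LambdaLoc L e dV hdV dW hdW v χ s) xv 1 *
        LambdaLoc L (Equiv.prodUnique (Fin 1) (Fin 1)) (fun _ => (1 : L)) (fun _ => map_one _) (fun _ => (1 : L)) (fun _ => map_one _) v χ (s - 1 / 2) (κ x) :=
  apply_eq_apply_one_mul_lambdaLoc_apply L v S hS hS' κ hκ χ (s - 1 / 2)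
    (innerSectionLoc_lambdaLoc_upper_mul L e dV hdV dW hdW v Ψv SAw Xw Yw aw haw hSAw hSAwi hΨv νY νT χ s hχ xv)
    (innerSectionLoc_lambdaLoc_mul_localInt L v νY νT e dV hdV dW hdW Ψv hΨK χ s hχ hxv) hχ h2 x

/-! ## §3 The per-place head at the bridge of record `Ψ_{S,v} = UnitaryGroup.localCongr … S … v` (★ C §5 shape) -/

include haw hSAw hSAwi hΨv in
/-- **THE PER-PLACE HEAD AT THE BRIDGE OF RECORD**: `J_v(x) = J_v(1) · Λ^{line}_{s−½,v}(Ψ_{S,v} x)` with `Ψ_{S,v} := ★ UnitaryGroup.localCongr L c S _ hc v` (§2 at `κ := Ψ_{S,v}`,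
`hκ := ★ localCongr_apply_eq_conj` — exactly as ★ C §5 `apply_eq_apply_one_mul_lambdaLoc_localCongr`), for `J_v := innerSectionLoc L v νY νT Ψv (LambdaLoc … v χ s) xv`, any
additive Haar `ν_T`, at a good place. [cite: Casselman1980, §3] [cite: Tan1999, §1] [cite: MoeglinWaldspurger1995, II.1.7] -/
theorem innerSectionLoc_lambdaLoc_eq_apply_one_mul_lambdaLoc_localCongr
    [MeasurableSpace ↥(skewLoc L v)] [BorelSpace ↥(skewLoc L v)] [MeasurableSpace (UnitaryGroup.LocalRing L v)] [BorelSpace (UnitaryGroup.LocalRing L v)]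
    (νY : Measure ↥(skewLoc L v)) (νT : Measure (UnitaryGroup.LocalRing L v)) [SFinite νY] [SFinite νT] [νY.IsAddLeftInvariant] [νT.IsAddHaarMeasure]
    (S : GL (Fin 2) L) (hS : (S : Matrix (Fin 2) (Fin 2) L) = !![1, 2⁻¹; 1, -2⁻¹])
    (hS' : ((S⁻¹ : GL (Fin 2) L) : Matrix (Fin 2) (Fin 2) L) = !![2⁻¹, 2⁻¹; 1, -1])
    (hc : formCongr (IsCMField.complexConj L : L →+* L) S
      (@HSMul.hSMul L (Matrix (Fin 2) (Fin 2) L) (Matrix (Fin 2) (Fin 2) L) instHSMul (1 : L)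
        (hermD L (Equiv.prodUnique (Fin 1) (Fin 1)) (fun _ => (1 : L)) (fun _ => map_one _) (fun _ => (1 : L)) (fun _ => map_one _))) =
      (StdForm.antidiagonal 2).over L)
    (χ : HeckeCharacter L) (s : ℂ) (hχ : ∀ w : UnitaryGroup.PlacesOver L v, χ.IsUnramifiedAt w.1)
    (h2 : ∀ w : UnitaryGroup.PlacesOver L v, ValuativeRel.valuation (w.1.adicCompletion L) (2 : w.1.adicCompletion L) = 1)
    (hΨK : ∀ k ∈ UnitaryGroup.localInt L (IsCMField.complexConj L) 4 ((StdForm.antidiagonal 4).over L) v,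
      Ψv k ∈ UnitaryGroup.localInt L (IsCMField.complexConj L) (2 + 2) (hermD L e dV hdV dW hdW) v)
    {xv : UnitaryGroup.localPi L (IsCMField.complexConj L) (2 + 2) (hermD L e dV hdV dW hdW) v}
    (hxv : xv ∈ UnitaryGroup.localInt L (IsCMField.complexConj L) (2 + 2) (hermD L e dV hdV dW hdW) v)
    (x : UnitaryGroup.localPi L (IsCMField.complexConj L) 2 ((StdForm.antidiagonal 2).over L) v) :
    innerSectionLoc L v νY νT Ψv (LambdaLoc L e dV hdV dW hdW v χ s) xv x =
      innerSectionLoc L v νY νT Ψv (LambdaLoc L e dV hdV dW hdW v χ s) xv 1 *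
        LambdaLoc L (Equiv.prodUnique (Fin 1) (Fin 1)) (fun _ => (1 : L)) (fun _ => map_one _) (fun _ => (1 : L)) (fun _ => map_one _) v χ (s - 1 / 2)
          ((UnitaryGroup.localCongr L (IsCMField.complexConj L) S one_ne_zero hc v :) x : UnitaryGroup.localPi L (IsCMField.complexConj L) (1 + 1)
            (hermD L (Equiv.prodUnique (Fin 1) (Fin 1)) (fun _ => (1 : L)) (fun _ => map_one _) (fun _ => (1 : L)) (fun _ => map_one _)) v) :=
  innerSectionLoc_lambdaLoc_eq_apply_one_mul_lambdaLoc L e dV hdV dW hdW v Ψv SAw Xw Yw aw haw hSAw hSAwi hΨv νY νT S hS hS'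
    (UnitaryGroup.localCongr L (IsCMField.complexConj L) S one_ne_zero hc v :) (localCongr_apply_eq_conj L v S hc) χ s hχ h2 hΨK hxv x

end Summit.HodgeConjecture.HodgeConjecture.Cruxes.HLiu418.K2LiuKlingenInnerSectionLocalLawAssembly

end
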